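import Summits.Ventures.HSemireg.WedgeHankelRecurrenceGaussZerosDiagonalMonotone

/-!
# Venture HSemireg — **THE ZEROS UNDER AFFINE CHANGES OF THE RECURRENCE, AND WEYL'S PERTURBATION BOUND**: translating the diagonal `a ↦ a + s` translates every zero by `s`
# (`q_n ↦ q_n(X − s)`); scaling `(a, b) ↦ (c a, c² b)` scales every zero by `c` (`q_n ↦ c^n q_n(X∕c)`), in particular the reflection `(a, b) ↦ (−a, b)` reverses and negates them;
# hence, with N323, `|a'_i − a_i| ≤ s` for `i ≤ t` (same `b`) forces `|x'_k − x_k| ≤ s` for every zero of `q_{t+1}`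

HONEST FRAMING. Part of the Lean index of the computation cell `pub-hsemireg` (seat p10 gen 44, Sunday typer «UNIFORM-IN-n»).  Real polynomials and finite products only; no variety, no
cohomology theory, no sheaf, no Ext group and no semiregularity map is constructed here; nothing here says that HC / HC_CM / HC_AV holds; no Literature fact (unproved `Prop`) is declared or used.
Custodian versions as in `WedgeHankelSiegelIdeal` (1/3).
SOURCES (cited).  H. Weyl, Math. Ann. 71 (1912) 441–479 (`|λ_k(A + E) − λ_k(A)| ≤ ‖E‖`); R. A. Horn, C. R. Johnson, *Matrix Analysis* (2nd ed.) Thm 4.3.1 ∕ Cor. 6.3.8; T. S. Chihara,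
*An Introduction to Orthogonal Polynomials* (1978) Ch. I §4 Ex. 4.1–4.2 (the recurrences of `q_n(x − s)` and of `c^n q_n(x∕c)`; symmetric case `a ≡ 0`); G. Szegő, *Orthogonal Polynomials* §2.3 (2.3.2).
PROOF TYPED HERE.  Two-step inductions on the recurrence for `q_n ∘ (X − s)` and `C(c^n)·q_n ∘ (c⁻¹X)`; the factorisations `∏ (X − (x_k + s))`, `∏ (X − c x_k)` (reindexed by `Fin.rev` when `c < 0`);
the perturbation bound is N323 `zeros_mono_diagonal` against the two translated recurrences `a − s ≤ a' ≤ a + s`.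
DEDUP DISCLOSURE (`rg -n 'comp \(Polynomial.X - C|translate|recurrence_scale|reflect' Summits/Ventures/HSemireg`, 2026-09-03): `Literature…RealTauKnownCases.coeff_comp_neg_X` (coefficients of
`p ∘ (−X)`) is unrelated bookkeeping; nothing on translated ∕ scaled recurrences in the tree.  The 9 names below: 0 hits tree-wide.

WHAT IS IN THE TREE.  N323 `zeros_mono_diagonal`; N294 `strictMono_eq_of_prod_X_sub_C_eq`; Mathlib `Polynomial.comp` algebra (`sub_comp`, `mul_comp`, `prod_comp`, `X_comp`, `C_comp`),
`Fin.revPerm`, `Fintype.prod_equiv`.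
THIS FILE (namespace `Summit.Ventures.HSemireg.Wedge.HankelOuter` continued; CHAINED on N323 (import); 0 definitions):
* §1089 **`recurrence_translate_spec`** (`q_n ∘ (X − s)` solves the recurrence `(a + s, b)` and factors as `∏ (X − (x_k + s))`), `recurrence_translate_unique` (any solution of `(a + s, b)` is it),
  **`recurrence_scale_spec`** (`C(c^n)·q_n ∘ (c⁻¹X)` solves `(c a, c² b)`, `c ≠ 0`, and factors as `∏ (X − c x_k)`), `recurrence_scale_unique`, `recurrence_scale_zeros_pos` (`c > 0`: zeros `c x_k`,
  increasing), **`recurrence_reflect_zeros`** (`(−a, b)`: zeros `−x_{t−k}`, increasing), `strictMono_neg_comp_rev`, **`zeros_translate_eq`** (a solution of `(a + s, b)` with increasing zeros `y` has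
  `y_k = x_k + s`), **`zeros_perturbation_diagonal`** (`|a'_i − a_i| ≤ s`, same `b > 0` ⇒ `|x'_k − x_k| ≤ s`).
CAVEATS.  Monic three-term recurrences over `ℝ`; the perturbation bound needs `b > 0` (real simple zeros via N279).  Nothing Ext-side.  New names only.
-/

open Module Polynomial
open scoped Matrix Polynomial

namespace Summit.Ventures.HSemireg.Wedge.HankelOuter

/-! ## §1089. Affine changes of the recurrence; Weyl's perturbation bound -/

/-- **TRANSLATION: `Q_n = q_n ∘ (X − s)` solves the recurrence with diagonal `a + s` and the same `b`, and `Q_{t+1} = ∏ (X − (x_k + s))` when `q_{t+1} = ∏ (X − x_k)`.**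
[Chihara Ch. I §4; this file, §1089] -/
theorem recurrence_translate_spec {q : ℕ → ℝ[X]} {a b : ℕ → ℝ} (hq0 : q 0 = 1) (hq1 : q 1 = Polynomial.X - C (a 0))
    (hrec : ∀ n, q (n + 2) = (Polynomial.X - C (a (n + 1))) * q (n + 1) - C (b (n + 1)) * q n) (s : ℝ) :
    (q 0).comp (Polynomial.X - C s) = 1 ∧ (q 1).comp (Polynomial.X - C s) = Polynomial.X - C (a 0 + s) ∧
      (∀ n, (q (n + 2)).comp (Polynomial.X - C s) = (Polynomial.X - C (a (n + 1) + s)) * (q (n + 1)).comp (Polynomial.X - C s) - C (b (n + 1)) * (q n).comp (Polynomial.X - C s)) ∧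
      ∀ {t : ℕ} {x : Fin (t + 1) → ℝ}, q (t + 1) = ∏ k, (Polynomial.X - C (x k)) → (q (t + 1)).comp (Polynomial.X - C s) = ∏ k, (Polynomial.X - C (x k + s)) := by
  refine ⟨by rw [hq0, one_comp], by rw [hq1, sub_comp, X_comp, C_comp, C_add]; ring, fun n => ?_, fun {t x} hxq => ?_⟩
  · rw [hrec n, sub_comp, mul_comp, mul_comp, sub_comp, X_comp, C_comp, C_comp, C_add]; ring
  · rw [hxq, prod_comp]
    exact Finset.prod_congr rfl fun k _ => by rw [sub_comp, X_comp, C_comp, C_add]; ring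

/-- **Uniqueness: every solution of the recurrence `(a + s, b)` is `q_n ∘ (X − s)`.** [this file, §1089] -/
theorem recurrence_translate_unique {q q' : ℕ → ℝ[X]} {a b : ℕ → ℝ} (hq0 : q 0 = 1) (hq1 : q 1 = Polynomial.X - C (a 0))
    (hrec : ∀ n, q (n + 2) = (Polynomial.X - C (a (n + 1))) * q (n + 1) - C (b (n + 1)) * q n) {s : ℝ}
    (hq0' : q' 0 = 1) (hq1' : q' 1 = Polynomial.X - C (a 0 + s))
    (hrec' : ∀ n, q' (n + 2) = (Polynomial.X - C (a (n + 1) + s)) * q' (n + 1) - C (b (n + 1)) * q' n) : ∀ n, q' n = (q n).comp (Polynomial.X - C s) := by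
  obtain ⟨h0, h1, h2, -⟩ := recurrence_translate_spec hq0 hq1 hrec s
  have key : ∀ n, q' n = (q n).comp (Polynomial.X - C s) ∧ q' (n + 1) = (q (n + 1)).comp (Polynomial.X - C s) := by
    intro n
    induction n with
    | zero => exact ⟨by rw [hq0', h0], by rw [hq1', h1]⟩
    | succ n ih => exact ⟨ih.2, by rw [hrec' n, h2 n, ih.1, ih.2]⟩
  exact fun n => (key n).1

/-- **SCALING: `Q_n = c^n · q_n ∘ (c⁻¹ X)` (`c ≠ 0`) solves the recurrence `(c a, c² b)`, and `Q_{t+1} = ∏ (X − c x_k)` when `q_{t+1} = ∏ (X − x_k)`.** [Chihara Ch. I §4; this file, §1089] -/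
theorem recurrence_scale_spec {q : ℕ → ℝ[X]} {a b : ℕ → ℝ} (hq0 : q 0 = 1) (hq1 : q 1 = Polynomial.X - C (a 0))
    (hrec : ∀ n, q (n + 2) = (Polynomial.X - C (a (n + 1))) * q (n + 1) - C (b (n + 1)) * q n) {c : ℝ} (hc : c ≠ 0) :
    C (c ^ 0) * (q 0).comp (C c⁻¹ * Polynomial.X) = 1 ∧ C (c ^ 1) * (q 1).comp (C c⁻¹ * Polynomial.X) = Polynomial.X - C (c * a 0) ∧
      (∀ n, C (c ^ (n + 2)) * (q (n + 2)).comp (C c⁻¹ * Polynomial.X) =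
        (Polynomial.X - C (c * a (n + 1))) * (C (c ^ (n + 1)) * (q (n + 1)).comp (C c⁻¹ * Polynomial.X)) - C (c ^ 2 * b (n + 1)) * (C (c ^ n) * (q n).comp (C c⁻¹ * Polynomial.X))) ∧
      ∀ {t : ℕ} {x : Fin (t + 1) → ℝ}, q (t + 1) = ∏ k, (Polynomial.X - C (x k)) → C (c ^ (t + 1)) * (q (t + 1)).comp (C c⁻¹ * Polynomial.X) = ∏ k, (Polynomial.X - C (c * x k)) := by
  have h1 : C c * C c⁻¹ = (1 : ℝ[X]) := by rw [← C_mul, mul_inv_cancel₀ hc, C_1]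
  refine ⟨by rw [hq0, one_comp, pow_zero, C_1, one_mul], ?_, fun n => ?_, fun {t x} hxq => ?_⟩
  · rw [hq1, sub_comp, X_comp, C_comp, pow_one, C_mul]
    linear_combination Polynomial.X * h1
  · rw [hrec n, sub_comp, mul_comp, mul_comp, sub_comp, X_comp, C_comp, C_comp]
    simp only [map_mul, map_pow]
    linear_combination ((C c) ^ (n + 1) * Polynomial.X * (q (n + 1)).comp (C c⁻¹ * Polynomial.X)) * h1
  · rw [hxq, prod_comp]
    have hf : ∀ k, (Polynomial.X - C (x k)).comp (C c⁻¹ * Polynomial.X) = C c⁻¹ * Polynomial.X - C (x k) := fun k => by rw [sub_comp, X_comp, C_comp]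
    simp_rw [hf]
    have hk : ∀ k : Fin (t + 1), Polynomial.X - C (c * x k) = C c * (C c⁻¹ * Polynomial.X - C (x k)) := fun k => by
      rw [C_mul]; linear_combination (-Polynomial.X) * h1
    simp_rw [hk]
    rw [Finset.prod_mul_distrib, Finset.prod_const, Finset.card_univ, Fintype.card_fin, map_pow]

/-- **Uniqueness for the scaled recurrence.** [this file, §1089] -/
theorem recurrence_scale_unique {q q' : ℕ → ℝ[X]} {a b : ℕ → ℝ} (hq0 : q 0 = 1) (hq1 : q 1 = Polynomial.X - C (a 0))
    (hrec : ∀ n, q (n + 2) = (Polynomial.X - C (a (n + 1))) * q (n + 1) - C (b (n + 1)) * q n) {c : ℝ} (hc : c ≠ 0)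
    (hq0' : q' 0 = 1) (hq1' : q' 1 = Polynomial.X - C (c * a 0))
    (hrec' : ∀ n, q' (n + 2) = (Polynomial.X - C (c * a (n + 1))) * q' (n + 1) - C (c ^ 2 * b (n + 1)) * q' n) :
    ∀ n, q' n = C (c ^ n) * (q n).comp (C c⁻¹ * Polynomial.X) := by
  obtain ⟨h0, h1, h2, -⟩ := recurrence_scale_spec hq0 hq1 hrec hc
  have key : ∀ n, q' n = C (c ^ n) * (q n).comp (C c⁻¹ * Polynomial.X) ∧ q' (n + 1) = C (c ^ (n + 1)) * (q (n + 1)).comp (C c⁻¹ * Polynomial.X) := by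
    intro n
    induction n with
    | zero => exact ⟨by rw [hq0', h0], by rw [hq1', h1]⟩
    | succ n ih => exact ⟨ih.2, by rw [hrec' n, h2 n, ih.1, ih.2]⟩
  exact fun n => (key n).1

/-- **Zeros of the scaled recurrence, `c > 0`: `q'_{t+1} = ∏ (X − c x_k)` with `k ↦ c x_k` increasing.** [this file, §1089] -/
theorem recurrence_scale_zeros_pos {q q' : ℕ → ℝ[X]} {a b : ℕ → ℝ} (hq0 : q 0 = 1) (hq1 : q 1 = Polynomial.X - C (a 0))
    (hrec : ∀ n, q (n + 2) = (Polynomial.X - C (a (n + 1))) * q (n + 1) - C (b (n + 1)) * q n) {c : ℝ} (hc : 0 < c)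
    (hq0' : q' 0 = 1) (hq1' : q' 1 = Polynomial.X - C (c * a 0))
    (hrec' : ∀ n, q' (n + 2) = (Polynomial.X - C (c * a (n + 1))) * q' (n + 1) - C (c ^ 2 * b (n + 1)) * q' n)
    {t : ℕ} {x : Fin (t + 1) → ℝ} (hx : StrictMono x) (hxq : q (t + 1) = ∏ k, (Polynomial.X - C (x k))) :
    StrictMono (fun k => c * x k) ∧ q' (t + 1) = ∏ k, (Polynomial.X - C (c * x k)) :=
  ⟨fun _ _ h => mul_lt_mul_of_pos_left (hx h) hc,
    by rw [recurrence_scale_unique hq0 hq1 hrec hc.ne' hq0' hq1' hrec' (t + 1)]; exact (recurrence_scale_spec hq0 hq1 hrec hc.ne').2.2.2 hxq⟩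

/-- `k ↦ −x_{t−k}` is increasing when `x` is. [bookkeeping; this file, §1089] -/
theorem strictMono_neg_comp_rev {t : ℕ} {x : Fin (t + 1) → ℝ} (hx : StrictMono x) : StrictMono (fun k : Fin (t + 1) => -x (Fin.rev k)) :=
  fun _ _ h => neg_lt_neg (hx (Fin.rev_lt_rev.2 h))

/-- **REFLECTION: a solution of the recurrence `(−a, b)` has `q'_{t+1} = ∏_k (X − (−x_{t−k}))`, the zeros `−x_{t−k}` increasing** (`q'_n = (−1)^n q_n(−X)`). [Chihara Ch. I §4 (symmetric case);
Szegő (2.3.2); this file, §1089] -/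
theorem recurrence_reflect_zeros {q q' : ℕ → ℝ[X]} {a b : ℕ → ℝ} (hq0 : q 0 = 1) (hq1 : q 1 = Polynomial.X - C (a 0))
    (hrec : ∀ n, q (n + 2) = (Polynomial.X - C (a (n + 1))) * q (n + 1) - C (b (n + 1)) * q n)
    (hq0' : q' 0 = 1) (hq1' : q' 1 = Polynomial.X - C (-a 0))
    (hrec' : ∀ n, q' (n + 2) = (Polynomial.X - C (-a (n + 1))) * q' (n + 1) - C (b (n + 1)) * q' n)
    {t : ℕ} {x : Fin (t + 1) → ℝ} (hx : StrictMono x) (hxq : q (t + 1) = ∏ k, (Polynomial.X - C (x k))) :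
    StrictMono (fun k : Fin (t + 1) => -x (Fin.rev k)) ∧ q' (t + 1) = ∏ k : Fin (t + 1), (Polynomial.X - C (-x (Fin.rev k))) := by
  have hq1'' : q' 1 = Polynomial.X - C ((-1 : ℝ) * a 0) := by rw [hq1', neg_one_mul]
  have hrec'' : ∀ n, q' (n + 2) = (Polynomial.X - C ((-1 : ℝ) * a (n + 1))) * q' (n + 1) - C ((-1 : ℝ) ^ 2 * b (n + 1)) * q' n := fun n => by
    rw [hrec' n, neg_one_mul]; norm_num
  refine ⟨strictMono_neg_comp_rev hx, ?_⟩
  rw [recurrence_scale_unique hq0 hq1 hrec (by norm_num : (-1 : ℝ) ≠ 0) hq0' hq1'' hrec'' (t + 1), (recurrence_scale_spec hq0 hq1 hrec (by norm_num : (-1 : ℝ) ≠ 0)).2.2.2 hxq]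
  exact Fintype.prod_equiv Fin.revPerm _ _ fun k => by simp [Fin.revPerm_apply, Fin.rev_rev]

/-- **A solution of `(a + s, b)` with increasing zeros `y` of `q'_{t+1}` has `y_k = x_k + s`.** [this file, §1089] -/
theorem zeros_translate_eq {q q' : ℕ → ℝ[X]} {a b : ℕ → ℝ} (hq0 : q 0 = 1) (hq1 : q 1 = Polynomial.X - C (a 0))
    (hrec : ∀ n, q (n + 2) = (Polynomial.X - C (a (n + 1))) * q (n + 1) - C (b (n + 1)) * q n) {s : ℝ}
    (hq0' : q' 0 = 1) (hq1' : q' 1 = Polynomial.X - C (a 0 + s))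
    (hrec' : ∀ n, q' (n + 2) = (Polynomial.X - C (a (n + 1) + s)) * q' (n + 1) - C (b (n + 1)) * q' n)
    {t : ℕ} {x y : Fin (t + 1) → ℝ} (hx : StrictMono x) (hxq : q (t + 1) = ∏ k, (Polynomial.X - C (x k))) (hy : StrictMono y)
    (hyq : q' (t + 1) = ∏ k, (Polynomial.X - C (y k))) : y = fun k => x k + s := by
  have hq : q' (t + 1) = ∏ k, (Polynomial.X - C (x k + s)) := by
    rw [recurrence_translate_unique hq0 hq1 hrec hq0' hq1' hrec' (t + 1)]
    exact (recurrence_translate_spec hq0 hq1 hrec s).2.2.2 hxq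
  exact strictMono_eq_of_prod_X_sub_C_eq hy (fun _ _ h => (add_lt_add_iff_right s).2 (hx h)) (hyq.symm.trans hq)

/-- **WEYL'S PERTURBATION BOUND FOR THE DIAGONAL: `|a'_i − a_i| ≤ s` for `i ≤ t` and the same `b > 0` ⇒ `|x'_k − x_k| ≤ s` for every zero of `q_{t+1}` ∕ `q'_{t+1}`.**
[Weyl 1912; Horn–Johnson Thm 4.3.1 ∕ Cor. 6.3.8; this file, §1089] -/
theorem zeros_perturbation_diagonal {q q' : ℕ → ℝ[X]} {a a' b : ℕ → ℝ} (hq0 : q 0 = 1) (hq1 : q 1 = Polynomial.X - C (a 0))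
    (hrec : ∀ n, q (n + 2) = (Polynomial.X - C (a (n + 1))) * q (n + 1) - C (b (n + 1)) * q n)
    (hq0' : q' 0 = 1) (hq1' : q' 1 = Polynomial.X - C (a' 0)) (hrec' : ∀ n, q' (n + 2) = (Polynomial.X - C (a' (n + 1))) * q' (n + 1) - C (b (n + 1)) * q' n)
    (hb : ∀ j, 0 < b j) {t : ℕ} {s : ℝ} (hs : ∀ i, i ≤ t → |a' i - a i| ≤ s)
    {x y : Fin (t + 1) → ℝ} (hx : StrictMono x) (hxq : q (t + 1) = ∏ j, (Polynomial.X - C (x j))) (hy : StrictMono y) (hyq : q' (t + 1) = ∏ j, (Polynomial.X - C (y j)))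
    (k : Fin (t + 1)) : |y k - x k| ≤ s := by
  -- the two translated recurrences `a + s` and `a + (−s)`
  obtain ⟨hp0, hp1, hprec, hpz⟩ := recurrence_translate_spec hq0 hq1 hrec s
  obtain ⟨hm0, hm1, hmrec, hmz⟩ := recurrence_translate_spec hq0 hq1 hrec (-s)
  have hxp : StrictMono (fun k => x k + s) := fun _ _ h => (add_lt_add_iff_right s).2 (hx h)
  have hxm : StrictMono (fun k => x k + -s) := fun _ _ h => (add_lt_add_iff_right (-s)).2 (hx h)
  -- `a' ≤ a + s` ⇒ `y_k ≤ x_k + s`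
  have hup : y k ≤ x k + s :=
    zeros_mono_diagonal (q := q') (q' := fun n => (q n).comp (Polynomial.X - C s)) (a := a') (a' := fun i => a i + s) hq0' hq1' hrec' hp0 hp1 hprec hb (fun i hi => by have := (abs_le.1 (hs i hi)).2; linarith)
      hy hyq hxp (hpz hxq) k
  -- `a − s ≤ a'` ⇒ `x_k − s ≤ y_k`
  have hdown : x k + -s ≤ y k :=
    zeros_mono_diagonal (q := fun n => (q n).comp (Polynomial.X - C (-s))) (q' := q') (a := fun i => a i + -s) (a' := a') hm0 hm1 hmrec hq0' hq1' hrec' hb (fun i hi => by have := (abs_le.1 (hs i hi)).1; linarith)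
      hxm (hmz hxq) hy hyq k
  rw [abs_le]
  constructor <;> linarith

end Summit.Ventures.HSemireg.Wedge.HankelOuter
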